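import Literature.Probability.LatticeModels.MixingErrorTerms
import Mathlib.Analysis.SpecialFunctions.Log.Basic
import Mathlib.Data.Nat.Log
import HarnessLib

/-!
# The dyadic grid of scales of the proof of Theorem 6.4 and the smallness of the error terms (Aizenman–Duminil-Copin 2021, §6.2)

Topic `Literature/Probability/LatticeModels`. Theorems only; **no named fact is introduced** (D-0026).

M. Aizenman, H. Duminil-Copin, Ann. of Math. **194** (2021) = arXiv:1912.07973, §6.2: the proof of Theorem 6.4
fixes intermediate scales `n ≤ m ≤ M ≤ N` ("`m/n = (N/n)^{1/3}`, `N/M = (N/n)^{1/3}`"; the exponents printed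
there do not balance the estimates of Lemma 6.7 — R. Panis, arXiv:2309.05797, §6.4 uses
`m/n = (N/n)^{μ/2}`, `N/M = (N/n)^{1-μ}`, `R = N^ι`), a splitting radius `R = √(MN)` of `Ann(M,N)` and
`r = √(nm)` of `Ann(n,m)`, and — for the regular-case relocation (6.9) used inside (6.20) — the same structure
one level down inside `Λ_m`. Only the ORDER relations between these scales matter ("`N ≥ n^{α₀}` for `α₀`
large enough"). This file fixes a concrete dyadic grid: with `Q = ⌊log₂ N⌋/10000`, every scale is a power
`2^{tQ}` (lower level: `r' = 2^{4Q}`, `m' = 2^{7Q}`, `M' = 2^{20Q}`, `R' = 2^{64Q}`, `N' = 2^{196Q}`; top level: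
`r = 2^{100Q}`, `m = 2^{200Q}`, `M = 2^{1000Q}`, `R = 2^{3100Q}`), and proves that for `N ≥ n^{20000}` all the
order relations required by `MixingBoxAAAG.box_mixingCore_prob` / `MixingBoxRelocation.box_relocation_regular`
hold and that the split-event errors (`MixingErrorTerms.splitErr`) are `≤ K·2^{-Q}`, while
`log(N/n) ≤ 20000 log 2 · Q` — so that everything is `O((log N/n)^{-1/2})`.

* `grid_spec` — `Q ≥ 1`, `n < 2^Q`, `2^{10000Q} ≤ N`, `log(N/n) ≤ 20000·log 2·Q`, and `Q ≥ Q₀` once `n ≥ 2^{Q₀+2}`;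
* `splitErr_top_le`, `splitErr_low_le` — the two split-event errors are `≤ K/2^Q`;
* `closeness_le` — `(1+ζ)⁴/(1-η)⁴ - 1 ≤ 32ζ + 11η` for `ζ ≤ 1`, `η ≤ 1/10`.

## References

* M. Aizenman, H. Duminil-Copin, Ann. of Math. 194 (2021), arXiv:1912.07973, §6.2, proof of Thm 6.4 and of
  Lemma 6.7 (pp. 23–26) [AizenmanDuminilCopinAnnals2021].
* R. Panis, arXiv:2309.05797, §6.4 (the choice of scales) [Panis2023Triviality].
-/

noncomputable section

namespace Literature.Probability.LatticeModels

/-! ### The grid parameter `Q` -/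

/-- **The grid parameter.** For `2 ≤ n` and `n^{20000} ≤ N`, with `Q = ⌊log₂ N⌋/10000`: `1 ≤ Q`, `n < 2^Q`,
`2^{10000Q} ≤ N`, `log(N/n) ≤ 20000·log 2·Q`; and `Q₀ ≤ Q` as soon as `2^{Q₀+2} ≤ n`. [folklore] -/
theorem grid_spec {n N Q₀ : ℕ} (hn : 2 ≤ n) (hnN : n ^ 20000 ≤ N) :
    1 ≤ Nat.log 2 N / 10000 ∧ n < 2 ^ (Nat.log 2 N / 10000) ∧ 2 ^ (10000 * (Nat.log 2 N / 10000)) ≤ N ∧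
      Real.log ((N : ℝ) / n) ≤ 20000 * Real.log 2 * (Nat.log 2 N / 10000 : ℕ) ∧
      (2 ^ (Q₀ + 2) ≤ n → Q₀ ≤ Nat.log 2 N / 10000) := by
  -- make the exponent opaque (tactics must not try to evaluate `2 ^ 20000`)
  obtain ⟨E, hE, hnE⟩ : ∃ E : ℕ, E = 20000 ∧ n ^ E ≤ N := ⟨_, rfl, hnN⟩
  clear hnN
  set J := Nat.log 2 N with hJ
  set Q := J / 10000 with hQ
  have hn0 : 0 < n := lt_of_lt_of_le (by norm_num) hn
  have hN0 : N ≠ 0 := by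
    intro h
    rw [h] at hnE
    exact absurd hnE (not_le.2 (pow_pos hn0 E))
  have hJle : 2 ^ J ≤ N := Nat.pow_log_le_self 2 hN0
  have hJlt : N < 2 ^ (J + 1) := Nat.lt_pow_succ_log_self (by norm_num) N
  have hQJ : 10000 * Q ≤ J := by rw [hQ, mul_comm]; exact Nat.div_mul_le_self J 10000
  have hJQ : J < 10000 * (Q + 1) := by
    have := Nat.lt_div_mul_add (show 0 < 10000 by norm_num) (a := J)
    rw [hQ]; linarith
  -- `J ≥ E = 20000` from `n ≥ 2`
  have hJ2 : E ≤ J := by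
    have h2 : 2 ^ E ≤ N := le_trans (Nat.pow_le_pow_left hn E) hnE
    exact Nat.le_log_of_pow_le (by norm_num) h2
  have hQ1 : 1 ≤ Q := by omega
  -- `n < 2^Q`
  have hnQ : n < 2 ^ Q := by
    have h1 : n ^ E < 2 ^ (10000 * (Q + 1)) := lt_of_le_of_lt hnE (hJlt.trans_le (Nat.pow_le_pow_right (by norm_num) hJQ))
    have h2 : 2 ^ (10000 * (Q + 1)) ≤ (2 ^ Q) ^ E := by
      rw [← pow_mul]; exact Nat.pow_le_pow_right (by norm_num) (by rw [hE]; omega)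
    exact lt_of_pow_lt_pow_left₀ E (Nat.zero_le _) (h1.trans_le h2)
  refine ⟨hQ1, hnQ, (Nat.pow_le_pow_right (by norm_num) hQJ).trans hJle, ?_, fun hQ₀ => ?_⟩
  · -- `log(N/n) ≤ log N < (J+1) log 2 ≤ 20000 Q log 2`
    have hn0 : (0 : ℝ) < n := by exact_mod_cast (show 0 < n by omega)
    have hN0' : (0 : ℝ) < N := by exact_mod_cast Nat.pos_of_ne_zero hN0
    have h1 : Real.log ((N : ℝ) / n) ≤ Real.log N := by
      rw [Real.log_div hN0'.ne' hn0.ne']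
      have : 0 ≤ Real.log n := Real.log_nonneg (by exact_mod_cast (show 1 ≤ n by omega))
      linarith
    have h2 : Real.log (N : ℝ) ≤ (J + 1 : ℕ) * Real.log 2 := by
      rw [← Real.log_pow]
      exact Real.log_le_log hN0' (by exact_mod_cast hJlt.le)
    have h3 : ((J + 1 : ℕ) : ℝ) ≤ 20000 * (Q : ℕ) := by
      have : J + 1 ≤ 20000 * Q := by omega
      exact_mod_cast this
    have hlog2 : 0 < Real.log 2 := Real.log_pos (by norm_num)
    calc Real.log ((N : ℝ) / n) ≤ (J + 1 : ℕ) * Real.log 2 := h1.trans h2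
      _ ≤ 20000 * (Q : ℕ) * Real.log 2 := mul_le_mul_of_nonneg_right h3 hlog2.le
      _ = 20000 * Real.log 2 * (Q : ℕ) := by ring
  · have h1 : 2 ^ ((Q₀ + 2) * E) ≤ N := by
      calc 2 ^ ((Q₀ + 2) * E) = (2 ^ (Q₀ + 2)) ^ E := by rw [← pow_mul]
        _ ≤ n ^ E := Nat.pow_le_pow_left hQ₀ _
        _ ≤ N := hnE
    have h2 : (Q₀ + 2) * E ≤ J := Nat.le_log_of_pow_le (by norm_num) h1
    rw [hE] at h2
    omega

/-! ### Smallness of the error terms -/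

/-- `(1+ζ)⁴/(1-η)⁴ - 1 ≤ 32ζ + 11η` for `0 ≤ ζ ≤ 1`, `0 ≤ η ≤ 1/10`. [folklore] -/
theorem closeness_le {ζ η : ℝ} (hζ0 : 0 ≤ ζ) (hζ1 : ζ ≤ 1) (hη0 : 0 ≤ η) (hη1 : η ≤ 1 / 10) :
    (1 + ζ) ^ 4 / (1 - η) ^ 4 - 1 ≤ 32 * ζ + 11 * η := by
  have h1η : 0 < 1 - η := by linarith
  have hup : (1 + ζ) ^ 4 ≤ 1 + 15 * ζ := by nlinarith [sq_nonneg ζ, pow_nonneg hζ0 3, pow_nonneg hζ0 4, mul_nonneg hζ0 hζ0]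
  have hinv : ((1 - η) ^ 4)⁻¹ ≤ 1 + 11 * η := by
    rw [inv_le_iff_one_le_mul₀ (pow_pos h1η 4)]
    nlinarith [sq_nonneg η, pow_nonneg hη0 3, pow_nonneg hη0 4, pow_nonneg hη0 5, mul_nonneg hη0 hη0,
      mul_nonneg (mul_nonneg hη0 hη0) hη0]
  rw [div_eq_mul_inv]
  have h0 : 0 ≤ ((1 - η) ^ 4)⁻¹ := by positivity
  calc (1 + ζ) ^ 4 * ((1 - η) ^ 4)⁻¹ - 1 ≤ (1 + 15 * ζ) * (1 + 11 * η) - 1 := by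
        have := mul_le_mul hup hinv h0 (by positivity); linarith
    _ = 15 * ζ + 11 * η + 165 * ζ * η := by ring
    _ ≤ 32 * ζ + 11 * η := by nlinarith [mul_nonneg hζ0 hη0]

/-- A power of two against `2^Q`: `2^{aQ} · 2^Q ≤ 2^{bQ}` when `a + 1 ≤ b` (`Q` arbitrary), in `ℝ`. [folklore] -/
theorem two_pow_mul_le {a b Q : ℕ} (hab : a + 1 ≤ b) : (2 : ℝ) ^ (a * Q) * 2 ^ Q ≤ 2 ^ (b * Q) := by
  rw [← pow_add]
  exact pow_le_pow_right₀ (by norm_num) (by nlinarith)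

/-- `eoff` on the grid: for `1 ≤ x`, `x³·2^Q ≤ y` and `2x ≤ y`, `eoff C x y ≤ 746496C²/2^Q`. [folklore] -/
theorem eoff_grid_le {CIR : ℝ} {x y Q : ℕ} (hx : 1 ≤ x) (hxy : 2 * x ≤ y) (h : x ^ 3 * 2 ^ Q ≤ y) :
    eoff CIR x y ≤ 746496 * CIR ^ 2 / 2 ^ Q := by
  refine (eoff_le hx hxy).trans ?_
  have hy : (0 : ℝ) < y := by exact_mod_cast (show 0 < y by omega)
  rw [div_le_div_iff₀ hy (by positivity)]
  have h' : ((x : ℝ) ^ 3) * 2 ^ Q ≤ y := by exact_mod_cast h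
  nlinarith [h', sq_nonneg CIR]

/-- **The outward chain-rule term on the grid**: with `M = 2^{iQ}`, `R = 2^{jQ}`, `3i+1 ≤ j`, `1 ≤ Q`, `η ≤ 1/2`
and `s_W = e⁻²/(32b_c)/(216(16M)³)`, the term is `≤ 1728 C_IR² (32 b_c e² 216·16³)/2^Q`. [folklore] -/
theorem chainOut_grid_le {CIR bc η : ℝ} (hbc : 0 < bc) (hη : η ≤ 1 / 2) {i j Q : ℕ} (hQ : 1 ≤ Q) (hij : 3 * i + 1 ≤ j) :
    (216 * ((2 ^ (j * Q) : ℕ) : ℝ) ^ 3) * ((CIR / ((2 ^ (j * Q) : ℕ) : ℝ) ^ 2) *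
      (CIR / ((2 ^ (j * Q) - 2 ^ (i * Q) : ℕ) : ℝ) ^ 2)) /
      ((1 - η) * (Real.exp (-2) / (32 * bc) / (216 * (16 * ((2 ^ (i * Q) : ℕ) : ℝ)) ^ 3))) ≤
      1728 * CIR ^ 2 * (32 * bc * Real.exp 2 * 216 * 16 ^ 3) / 2 ^ Q := by
  have h1η : (1 : ℝ) / 2 ≤ 1 - η := by linarith
  have hsW : 0 < Real.exp (-2) / (32 * bc) / (216 * (16 * ((2 ^ (i * Q) : ℕ) : ℝ)) ^ 3) := by positivity
  have hMR : 2 * 2 ^ (i * Q) ≤ 2 ^ (j * Q) := by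
    calc 2 * 2 ^ (i * Q) = 2 ^ (i * Q + 1) := by ring
      _ ≤ 2 ^ (j * Q) := Nat.pow_le_pow_right (by norm_num) (by nlinarith)
  refine (chainOutTerm_le (CIR := CIR) (M := 2 ^ (i * Q)) (R := 2 ^ (j * Q)) Nat.one_le_two_pow hMR (by linarith) hsW).trans ?_
  have hR : (0 : ℝ) < ((2 ^ (j * Q) : ℕ) : ℝ) := by positivity
  rw [div_le_div_iff₀ (mul_pos hR (mul_pos (by linarith) hsW)) (by positivity)]
  have hM : (((2 ^ (i * Q) : ℕ) : ℝ)) ^ 3 * 2 ^ Q ≤ ((2 ^ (j * Q) : ℕ) : ℝ) := by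
    have : (2 ^ (i * Q)) ^ 3 * 2 ^ Q ≤ 2 ^ (j * Q) := by
      rw [← pow_mul, ← pow_add]; exact Nat.pow_le_pow_right (by norm_num) (by nlinarith)
    exact_mod_cast this
  have hsWe : Real.exp (-2) / (32 * bc) / (216 * (16 * ((2 ^ (i * Q) : ℕ) : ℝ)) ^ 3) *
      (32 * bc * Real.exp 2 * 216 * 16 ^ 3) * ((2 ^ (i * Q) : ℕ) : ℝ) ^ 3 = 1 := by
    rw [Real.exp_neg]; field_simp
  calc 864 * CIR ^ 2 * 2 ^ Q
      = 864 * CIR ^ 2 * 2 ^ Q * (Real.exp (-2) / (32 * bc) / (216 * (16 * ((2 ^ (i * Q) : ℕ) : ℝ)) ^ 3) *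
          (32 * bc * Real.exp 2 * 216 * 16 ^ 3) * ((2 ^ (i * Q) : ℕ) : ℝ) ^ 3) := by rw [hsWe, mul_one]
    _ = (864 * CIR ^ 2 * (32 * bc * Real.exp 2 * 216 * 16 ^ 3)) * ((((2 ^ (i * Q) : ℕ) : ℝ)) ^ 3 * 2 ^ Q) *
          (Real.exp (-2) / (32 * bc) / (216 * (16 * ((2 ^ (i * Q) : ℕ) : ℝ)) ^ 3)) := by ring
    _ ≤ (864 * CIR ^ 2 * (32 * bc * Real.exp 2 * 216 * 16 ^ 3)) * ((2 ^ (j * Q) : ℕ) : ℝ) *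
          (Real.exp (-2) / (32 * bc) / (216 * (16 * ((2 ^ (i * Q) : ℕ) : ℝ)) ^ 3)) := by gcongr
    _ ≤ 1728 * CIR ^ 2 * (32 * bc * Real.exp 2 * 216 * 16 ^ 3) *
          (((2 ^ (j * Q) : ℕ) : ℝ) * ((1 - η) * (Real.exp (-2) / (32 * bc) / (216 * (16 * ((2 ^ (i * Q) : ℕ) : ℝ)) ^ 3)))) := by
        have hK : 0 ≤ CIR ^ 2 * (32 * bc * Real.exp 2 * 216 * 16 ^ 3) * ((2 ^ (j * Q) : ℕ) : ℝ) *
            (Real.exp (-2) / (32 * bc) / (216 * (16 * ((2 ^ (i * Q) : ℕ) : ℝ)) ^ 3)) := by positivity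
        nlinarith [hK, h1η]

/-- **The inward chain-rule term on the grid**: with `r = 2^{iQ}`, `m = 2^{jQ}`, `3i+1 ≤ 2j`, `1 ≤ Q`,
`η ≤ 1/2`, `θ ≥ 0`: the term is `≤ 1728 θ C_IR/2^Q`. [folklore] -/
theorem chainIn_grid_le {CIR η θ : ℝ} (hC : 0 ≤ CIR) (hη : η ≤ 1 / 2) (hθ : 0 ≤ θ) {i j Q : ℕ} (hQ : 1 ≤ Q)
    (hij : 3 * i + 1 ≤ 2 * j) :
    θ * (216 * ((2 ^ (i * Q) : ℕ) : ℝ) ^ 3) * (CIR / ((2 ^ (j * Q) - 2 ^ (i * Q) : ℕ) : ℝ) ^ 2) / (1 - η) ≤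
      1728 * θ * CIR / 2 ^ Q := by
  have h1η : (1 : ℝ) / 2 ≤ 1 - η := by linarith
  have hrm : 2 * 2 ^ (i * Q) ≤ 2 ^ (j * Q) := by
    calc 2 * 2 ^ (i * Q) = 2 ^ (i * Q + 1) := by ring
      _ ≤ 2 ^ (j * Q) := Nat.pow_le_pow_right (by norm_num) (by nlinarith)
  refine (chainInTerm_le (CIR := CIR) (θ := θ) (r := 2 ^ (i * Q)) (m := 2 ^ (j * Q)) Nat.one_le_two_pow hrm
    (by linarith) hθ hC).trans ?_
  have hm : (0 : ℝ) < ((2 ^ (j * Q) : ℕ) : ℝ) ^ 2 * (1 - η) := by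
    have : (0:ℝ) < 1 - η := by linarith
    positivity
  rw [div_le_div_iff₀ hm (by positivity)]
  have hr : (((2 ^ (i * Q) : ℕ) : ℝ)) ^ 3 * 2 ^ Q ≤ ((2 ^ (j * Q) : ℕ) : ℝ) ^ 2 := by
    have : (2 ^ (i * Q)) ^ 3 * 2 ^ Q ≤ (2 ^ (j * Q)) ^ 2 := by
      rw [← pow_mul, ← pow_add, ← pow_mul]; exact Nat.pow_le_pow_right (by norm_num) (by nlinarith)
    exact_mod_cast this
  have h0 : 0 ≤ θ * CIR * (((2 ^ (j * Q) : ℕ) : ℝ)) ^ 2 := by positivity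
  have h00 : 0 ≤ θ * CIR := by positivity
  nlinarith [hr, h1η, h0, mul_nonneg h00 (pow_nonneg (Nat.cast_nonneg (2 ^ (i * Q))) 3)]

/-- **The top-level split-event error is `≤ K_top/2^Q`** on the grid (`n < 2^Q`, `1 ≤ n`, `2^{10000Q} ≤ N`,
`0 ≤ η ≤ 1/2`, `Q ≥ 1`), with `s_W = e⁻²/(32 b_c)/(216(16M)³)`, `M = 2^{1000Q}`. [cite: AizenmanDuminilCopinAnnals2021, arXiv:1912.07973 §6.2, proof of Lemma 6.7 ("≤ (n/N)^ε", p. 25)] -/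
theorem splitErr_top_le {CIR bc η : ℝ} (hC : 0 ≤ CIR) (hbc : 0 < bc) (hη : η ≤ 1 / 2) {n N Q : ℕ}
    (hQ : 1 ≤ Q) (hn : 1 ≤ n) (hnQ : n < 2 ^ Q) (hN : 2 ^ (10000 * Q) ≤ N) :
    splitErr CIR η (Real.exp (-2) / (32 * bc) / (216 * (16 * ((2 ^ (1000 * Q) : ℕ) : ℝ)) ^ 3)) 1 n
        (2 ^ (100 * Q)) (2 ^ (200 * Q)) (2 ^ (200 * Q) - 1) (2 ^ (1000 * Q)) (2 ^ (3100 * Q)) (N - 1) ≤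
      (2 * (746496 * CIR ^ 2 + 746496 * CIR ^ 2) +
        2 * (1728 * CIR ^ 2 * (32 * bc * Real.exp 2 * 216 * 16 ^ 3) + 746496 * CIR ^ 2 + 1728 * CIR + 746496 * CIR ^ 2)) /
        2 ^ Q := by
  have hN1 : N - 1 + 1 = N := by
    have : 1 ≤ N := le_trans (Nat.one_le_two_pow) hN
    omega
  have hm1 : 2 ^ (200 * Q) - 1 + 1 = 2 ^ (200 * Q) := Nat.sub_add_cancel Nat.one_le_two_pow
  -- the six terms
  have t1 : eoff CIR (2 ^ (1000 * Q)) (N - 1 + 1) ≤ 746496 * CIR ^ 2 / 2 ^ Q := by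
    rw [hN1]
    refine eoff_grid_le Nat.one_le_two_pow ?_ ?_
    · calc 2 * 2 ^ (1000 * Q) = 2 ^ (1000 * Q + 1) := by ring
        _ ≤ 2 ^ (10000 * Q) := Nat.pow_le_pow_right (by norm_num) (by omega)
        _ ≤ N := hN
    · calc (2 ^ (1000 * Q)) ^ 3 * 2 ^ Q = 2 ^ (3001 * Q) := by rw [← pow_mul, ← pow_add]; ring_nf
        _ ≤ 2 ^ (10000 * Q) := Nat.pow_le_pow_right (by norm_num) (by omega)
        _ ≤ N := hN
  have t2 : eoff CIR n (2 ^ (200 * Q) - 1 + 1) ≤ 746496 * CIR ^ 2 / 2 ^ Q := by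
    rw [hm1]
    refine eoff_grid_le hn ?_ ?_
    · calc 2 * n ≤ 2 * 2 ^ Q := by omega
        _ = 2 ^ (Q + 1) := by ring
        _ ≤ 2 ^ (200 * Q) := Nat.pow_le_pow_right (by norm_num) (by omega)
    · calc n ^ 3 * 2 ^ Q ≤ (2 ^ Q) ^ 3 * 2 ^ Q := Nat.mul_le_mul_right _ (Nat.pow_le_pow_left hnQ.le 3)
        _ = 2 ^ (4 * Q) := by rw [← pow_mul, ← pow_add]; ring_nf
        _ ≤ 2 ^ (200 * Q) := Nat.pow_le_pow_right (by norm_num) (by omega)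
  have t3 := chainOut_grid_le (CIR := CIR) hbc hη (i := 1000) (j := 3100) hQ (by norm_num)
  have t4 : eoff CIR (2 ^ (3100 * Q)) (N - 1 + 1) ≤ 746496 * CIR ^ 2 / 2 ^ Q := by
    rw [hN1]
    refine eoff_grid_le Nat.one_le_two_pow ?_ ?_
    · calc 2 * 2 ^ (3100 * Q) = 2 ^ (3100 * Q + 1) := by ring
        _ ≤ 2 ^ (10000 * Q) := Nat.pow_le_pow_right (by norm_num) (by omega)
        _ ≤ N := hN
    · calc (2 ^ (3100 * Q)) ^ 3 * 2 ^ Q = 2 ^ (9301 * Q) := by rw [← pow_mul, ← pow_add]; ring_nf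
        _ ≤ 2 ^ (10000 * Q) := Nat.pow_le_pow_right (by norm_num) (by omega)
        _ ≤ N := hN
  have t5 := chainIn_grid_le (θ := 1) hC hη zero_le_one (i := 100) (j := 200) hQ (by norm_num)
  have t6 : eoff CIR n (2 ^ (100 * Q)) ≤ 746496 * CIR ^ 2 / 2 ^ Q := by
    refine eoff_grid_le hn ?_ ?_
    · calc 2 * n ≤ 2 * 2 ^ Q := by omega
        _ = 2 ^ (Q + 1) := by ring
        _ ≤ 2 ^ (100 * Q) := Nat.pow_le_pow_right (by norm_num) (by omega)
    · calc n ^ 3 * 2 ^ Q ≤ (2 ^ Q) ^ 3 * 2 ^ Q := Nat.mul_le_mul_right _ (Nat.pow_le_pow_left hnQ.le 3)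
        _ = 2 ^ (4 * Q) := by rw [← pow_mul, ← pow_add]; ring_nf
        _ ≤ 2 ^ (100 * Q) := Nat.pow_le_pow_right (by norm_num) (by omega)
  unfold splitErr
  have h := add_le_add (mul_le_mul_of_nonneg_left (add_le_add t1 t2) zero_le_two)
    (mul_le_mul_of_nonneg_left (add_le_add (add_le_add (add_le_add t3 t4) t5) t6) zero_le_two)
  refine h.trans (le_of_eq ?_)
  ring

/-- **The lower-level split-event error is `≤ K_low/2^Q`** on the grid (radii `r' = 2^{4Q}`, `m' = 2^{7Q}`,
`M' = 2^{20Q}`, `R' = 2^{64Q}`, `N' = 2^{196Q}`, domination factor `θ = 1 + 4C₀`, `s_W' = e⁻²/(32b_c)/(216(16M')³)`).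
[cite: AizenmanDuminilCopinAnnals2021, arXiv:1912.07973 §6.2, proof of Lemma 6.7 ("≤ (n/N)^ε", p. 25)] -/
theorem splitErr_low_le {CIR bc η C₀ : ℝ} (hC : 0 ≤ CIR) (hbc : 0 < bc) (hη : η ≤ 1 / 2) (hC₀ : 0 ≤ C₀) {n Q : ℕ}
    (hQ : 1 ≤ Q) (hn : 1 ≤ n) (hnQ : n < 2 ^ Q) :
    splitErr CIR η (Real.exp (-2) / (32 * bc) / (216 * (16 * ((2 ^ (20 * Q) : ℕ) : ℝ)) ^ 3)) (1 + 4 * C₀) n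
        (2 ^ (4 * Q)) (2 ^ (7 * Q)) (2 ^ (7 * Q) - 1) (2 ^ (20 * Q)) (2 ^ (64 * Q)) (2 ^ (196 * Q)) ≤
      (2 * (746496 * CIR ^ 2 + 746496 * CIR ^ 2) +
        2 * (1728 * CIR ^ 2 * (32 * bc * Real.exp 2 * 216 * 16 ^ 3) + 746496 * CIR ^ 2 + 1728 * (1 + 4 * C₀) * CIR +
          746496 * CIR ^ 2)) / 2 ^ Q := by
  have hm1 : 2 ^ (7 * Q) - 1 + 1 = 2 ^ (7 * Q) := Nat.sub_add_cancel Nat.one_le_two_pow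
  have t1 : eoff CIR (2 ^ (20 * Q)) (2 ^ (196 * Q) + 1) ≤ 746496 * CIR ^ 2 / 2 ^ Q := by
    refine eoff_grid_le Nat.one_le_two_pow ?_ ?_
    · calc 2 * 2 ^ (20 * Q) = 2 ^ (20 * Q + 1) := by ring
        _ ≤ 2 ^ (196 * Q) := Nat.pow_le_pow_right (by norm_num) (by omega)
        _ ≤ 2 ^ (196 * Q) + 1 := Nat.le_succ _
    · calc (2 ^ (20 * Q)) ^ 3 * 2 ^ Q = 2 ^ (61 * Q) := by rw [← pow_mul, ← pow_add]; ring_nf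
        _ ≤ 2 ^ (196 * Q) := Nat.pow_le_pow_right (by norm_num) (by omega)
        _ ≤ 2 ^ (196 * Q) + 1 := Nat.le_succ _
  have t2 : eoff CIR n (2 ^ (7 * Q) - 1 + 1) ≤ 746496 * CIR ^ 2 / 2 ^ Q := by
    rw [hm1]
    refine eoff_grid_le hn ?_ ?_
    · calc 2 * n ≤ 2 * 2 ^ Q := by omega
        _ = 2 ^ (Q + 1) := by ring
        _ ≤ 2 ^ (7 * Q) := Nat.pow_le_pow_right (by norm_num) (by omega)
    · calc n ^ 3 * 2 ^ Q ≤ (2 ^ Q) ^ 3 * 2 ^ Q := Nat.mul_le_mul_right _ (Nat.pow_le_pow_left hnQ.le 3)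
        _ = 2 ^ (4 * Q) := by rw [← pow_mul, ← pow_add]; ring_nf
        _ ≤ 2 ^ (7 * Q) := Nat.pow_le_pow_right (by norm_num) (by omega)
  have t3 := chainOut_grid_le (CIR := CIR) hbc hη (i := 20) (j := 64) hQ (by norm_num)
  have t4 : eoff CIR (2 ^ (64 * Q)) (2 ^ (196 * Q) + 1) ≤ 746496 * CIR ^ 2 / 2 ^ Q := by
    refine eoff_grid_le Nat.one_le_two_pow ?_ ?_
    · calc 2 * 2 ^ (64 * Q) = 2 ^ (64 * Q + 1) := by ring
        _ ≤ 2 ^ (196 * Q) := Nat.pow_le_pow_right (by norm_num) (by omega)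
        _ ≤ 2 ^ (196 * Q) + 1 := Nat.le_succ _
    · calc (2 ^ (64 * Q)) ^ 3 * 2 ^ Q = 2 ^ (193 * Q) := by rw [← pow_mul, ← pow_add]; ring_nf
        _ ≤ 2 ^ (196 * Q) := Nat.pow_le_pow_right (by norm_num) (by omega)
        _ ≤ 2 ^ (196 * Q) + 1 := Nat.le_succ _
  have hθ : (0 : ℝ) ≤ 1 + 4 * C₀ := by positivity
  have t5 := chainIn_grid_le (θ := 1 + 4 * C₀) hC hη hθ (i := 4) (j := 7) hQ (by norm_num)
  have t6 : eoff CIR n (2 ^ (4 * Q)) ≤ 746496 * CIR ^ 2 / 2 ^ Q := by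
    refine eoff_grid_le hn ?_ ?_
    · calc 2 * n ≤ 2 * 2 ^ Q := by omega
        _ = 2 ^ (Q + 1) := by ring
        _ ≤ 2 ^ (4 * Q) := Nat.pow_le_pow_right (by norm_num) (by omega)
    · calc n ^ 3 * 2 ^ Q ≤ (2 ^ Q) ^ 3 * 2 ^ Q := Nat.mul_le_mul_right _ (Nat.pow_le_pow_left hnQ.le 3)
        _ = 2 ^ (4 * Q) := by rw [← pow_mul, ← pow_add]; ring_nf
        _ ≤ 2 ^ (4 * Q) := le_rfl
  unfold splitErr
  have h := add_le_add (mul_le_mul_of_nonneg_left (add_le_add t1 t2) zero_le_two)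
    (mul_le_mul_of_nonneg_left (add_le_add (add_le_add (add_le_add t3 t4) t5) t6) zero_le_two)
  refine h.trans (le_of_eq ?_)
  ring

end Literature.Probability.LatticeModels
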